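import Literature.Algebra.GroupRings.CharpolyQuotientRankTwo
import Literature.NumberTheory.Automorphic.BurnsideKolchin
import Mathlib.LinearAlgebra.Matrix.Action
import Mathlib.LinearAlgebra.Matrix.ToLin
import Mathlib.RepresentationTheory.Intertwining
import Mathlib.RepresentationTheory.Irreducible
import Mathlib.RingTheory.SimpleModule.Isotypic
import Mathlib.Tactic
import HarnessLib

/-!
# Boston–Lenstra–Ribet, module form: isotypic decomposition under rank-two Cayley–Hamilton relations

Companion of `CharpolyQuotientRankTwo.lean` (the ring form of the theorem of N. Boston,
H. W. Lenstra and K. Ribet, *Quotients of group rings arising from two-dimensional representations*,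
C. R. Acad. Sci. Paris 312 (1991) 323–328 [BostonLenstraRibet1991]). Here `k` is a field,
`ρ : G → M₂(k)` is multiplicative with `MonoidAlgebra.lift ρ : k[G] → M₂(k)` onto (absolute
irreducibility), and `σ` is a `k`-linear representation of `G` on `M` such that every `g ∈ G` is
annihilated on `M` by the characteristic polynomial of `ρ(g)`:
`σ(g)² - tr ρ(g) σ(g) + det ρ(g) = 0`. Writing `V_ρ` for the standard representation
`g ↦ (v ↦ ρ(g) v)` on `Fin 2 → k` (Mathlib: `(Representation.ofDistribMulAction k M₂(k) k²).comp ρ`,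
the same shape as the tree's `glStdRepresentation`), we prove Theorem 1 of [BLR] as printed
("`M` is a direct sum of copies of `V_ρ`"), in Mathlib's module language on `σ.asModule`:

* `isSemisimpleModule_of_charpolyRel` — `M` is a semisimple `k[G]`-module;
* `isIsotypicOfType_of_charpolyRel` — every simple `k[G]`-submodule of `M` is `≅ V_ρ`;
* `exists_linearEquiv_finsupp_of_charpolyRel` — `M ≅ ⨁_{ι} V_ρ` (`ι →₀ V_ρ.asModule`);
* `exists_linearEquiv_fin_of_charpolyRel`, `exists_finrank_eq_two_mul_of_charpolyRel` — for `M`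
  finite-dimensional: `M ≅ V_ρ^n` and `dim_k M = 2n` (the "multiplicity" `n` of Ribet–Stein §3.3);
* `lift_surjective_of_isIrreducible` — Burnside's theorem as the bridge from Mathlib's
  `Representation.IsIrreducible` (over an algebraically closed field) to the surjectivity
  hypothesis, via the tree's `Literature.NumberTheory.Automorphic.ActsIrreducibly.eq_top`.

Proof of the structure (ours, elementary): see `structure_aux`; the packaging into `ι →₀ V_ρ` /
`Fin n → V_ρ` is Mathlib's `IsIsotypicOfType.linearEquiv_finsupp` / `linearEquiv_fun`.
-- TODO(general form): a `Representation.Equiv σ (V_ρ.finsupp ι)` packaging is not spelled out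
-- (transport along `Representation.IntertwiningMap.equivLinearMapAsModule`).

## References
* N. Boston, H. W. Lenstra, K. A. Ribet, C. R. Acad. Sci. Paris Sér. I 312 (1991) 323–328
  [BostonLenstraRibet1991], Thm. 1 (as reported in G. Wiese, Algebra Number Theory 1 (2007)
  Prop. 4.1, and K. Ribet – W. Stein, Lectures on Serre's conjectures [RibetStein2008] §3.3).
* T. Y. Lam, A First Course in Noncommutative Rings [Lam2001FirstCourse], (7.3) (Burnside).
-/

namespace Literature.Algebra.GroupRings

open MonoidAlgebra

universe u

section Field

variable {k : Type*} [Field k] {G : Type*} [Group G]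

/-- The group-ring action on the standard module of a matrix-valued `ρ : G → M₂(k)` is
`x • v = (lift ρ x) v`: `asAlgebraHom` of the representation `g ↦ (ρ g • ·)` is matrix–vector
multiplication by `MonoidAlgebra.lift ρ x`. Private plumbing. [folklore] -/
private theorem std_asAlgebraHom_apply (ρ : G →* Matrix (Fin 2) (Fin 2) k)
    (x : MonoidAlgebra k G) (v : Fin 2 → k) : Representation.asAlgebraHom
      ((Representation.ofDistribMulAction k (Matrix (Fin 2) (Fin 2) k) (Fin 2 → k)).comp ρ) x v
      = (MonoidAlgebra.lift k (Matrix (Fin 2) (Fin 2) k) G ρ x).mulVec v := by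
  induction x using MonoidAlgebra.induction_on generalizing v with
  | hM g =>
    rw [Representation.asAlgebraHom_of, lift_of, MonoidHom.comp_apply,
      Representation.ofDistribMulAction_apply_apply, Matrix.smul_eq_mulVec]
  | hadd x y ex ey => rw [map_add, map_add, LinearMap.add_apply, ex, ey, Matrix.add_mulVec]
  | hsmul r x ex => rw [map_smul, map_smul, LinearMap.smul_apply, ex, Matrix.smul_mulVec]

/-- If `MonoidAlgebra.lift ρ : k[G] → M₂(k)` is onto, the standard `k[G]`-module `k²` of `ρ` is
simple (any non-zero vector is moved to any other by some matrix). Private plumbing. [folklore] -/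
private theorem isSimpleModule_std_asModule (ρ : G →* Matrix (Fin 2) (Fin 2) k)
    (hρ : Function.Surjective (MonoidAlgebra.lift k (Matrix (Fin 2) (Fin 2) k) G ρ)) :
    IsSimpleModule (MonoidAlgebra k G) (Representation.asModule
      ((Representation.ofDistribMulAction k (Matrix (Fin 2) (Fin 2) k) (Fin 2 → k)).comp ρ)) := by
  classical
  set V : Representation k G (Fin 2 → k) :=
    (Representation.ofDistribMulAction k (Matrix (Fin 2) (Fin 2) k) (Fin 2 → k)).comp ρ
  rw [isSimpleModule_iff_toSpanSingleton_surjective]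
  refine ⟨?_, fun w hw u => ?_⟩
  · -- `Fin 2 → k` is nontrivial
    exact V.asModuleEquiv.toEquiv.nontrivial
  · -- some coordinate of `w` is nonzero; hit `u` with a matrix supported on that column
    have hw' : V.asModuleEquiv w ≠ 0 := fun h => hw (by simpa using h)
    obtain ⟨i, hi⟩ : ∃ i, V.asModuleEquiv w i ≠ 0 := by
      by_contra h; push Not at h; exact hw' (funext h)
    set X : Matrix (Fin 2) (Fin 2) k :=
      Matrix.of fun a b => if b = i then V.asModuleEquiv u a / V.asModuleEquiv w i else 0 with hX
    have hXw : X.mulVec (V.asModuleEquiv w) = V.asModuleEquiv u := by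
      ext a
      simp [X, Matrix.mulVec, dotProduct, hi]
    obtain ⟨x, hx⟩ := hρ X
    refine ⟨x, ?_⟩
    apply V.asModuleEquiv.injective
    rw [LinearMap.toSpanSingleton_apply, Representation.asModuleEquiv_map_smul,
      std_asAlgebraHom_apply, hx, hXw]

/-- **Structural lemma** (the content of [BLR, Thm. 1] over a field, module form): under the
Cayley–Hamilton relations and surjectivity of `lift ρ`, the `k[G]`-module `M` is semisimple and
every simple submodule is isomorphic to the standard module `k²` of `ρ`. Proof: `σ` extends to
`θ : M₂(k) → End_k(M)` (`exists_algHom_comp_lift_eq_of_charpolyRel`); with the matrix units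
`E_ij := θ(e_ij)`, every `0 ≠ w ∈ E₀₀M` spans a copy `v ↦ v₀ w + v₁ E₁₀ w` of `k²`, these copies
cover `M = E₀₀M + E₁₀E₀₁M`, and every simple submodule contains one. Private; the public
statements follow. [cite: BostonLenstraRibet1991, Thm. 1] -/
private theorem structure_aux (ρ : G →* Matrix (Fin 2) (Fin 2) k)
    (hρ : Function.Surjective (MonoidAlgebra.lift k (Matrix (Fin 2) (Fin 2) k) G ρ))
    {M : Type*} [AddCommGroup M] [Module k M] (σ : Representation k G M)
    (hσ : ∀ g : G, σ g * σ g - (ρ g).trace • σ g + (ρ g).det • (1 : Module.End k M) = 0) :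
    IsSemisimpleModule (MonoidAlgebra k G) σ.asModule ∧
      IsIsotypicOfType (MonoidAlgebra k G) σ.asModule (Representation.asModule
        ((Representation.ofDistribMulAction k (Matrix (Fin 2) (Fin 2) k) (Fin 2 → k)).comp ρ)) := by
  classical
  set φ := MonoidAlgebra.lift k (Matrix (Fin 2) (Fin 2) k) G ρ with hφ
  set V : Representation k G (Fin 2 → k) :=
    (Representation.ofDistribMulAction k (Matrix (Fin 2) (Fin 2) k) (Fin 2 → k)).comp ρ with hV
  haveI : IsSimpleModule (MonoidAlgebra k G) V.asModule := isSimpleModule_std_asModule ρ hρ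
  obtain ⟨θ, hθ⟩ := exists_algHom_comp_lift_eq_of_charpolyRel ρ hρ σ.asAlgebraHom
    (fun g => by simpa only [Representation.asAlgebraHom_of] using hσ g)
  have hψ : ∀ x, σ.asAlgebraHom x = θ (φ x) := fun x => by rw [← hθ]; rfl
  -- matrix units acting on `M`
  set E : Fin 2 → Fin 2 → Module.End k M := fun i j => θ (Matrix.single i j 1) with hE
  have hEEv : ∀ (i j l : Fin 2) (m : M), E i j (E j l m) = E i l m := by
    intro i j l m
    rw [← Module.End.mul_apply, ← map_mul, Matrix.single_mul_single_same, mul_one]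
  have hEEv' : ∀ (i j j' l : Fin 2) (m : M), j ≠ j' → E i j (E j' l m) = 0 := by
    intro i j j' l m hjj'
    rw [← Module.End.mul_apply, ← map_mul, Matrix.single_mul_single_of_ne _ _ _ _ hjj', map_zero,
      LinearMap.zero_apply]
  have hE1v : ∀ m : M, E 0 0 m + E 1 1 m = m := by
    intro m
    rw [← LinearMap.add_apply, ← map_add,
      show Matrix.single (0 : Fin 2) (0 : Fin 2) (1 : k) + Matrix.single 1 1 1 = 1 from by
        ext i j; fin_cases i <;> fin_cases j <;> simp [Matrix.single],
      map_one, Module.End.one_apply]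
  -- the action of a preimage of a matrix unit
  have hEsmul : ∀ (i j : Fin 2) (m : σ.asModule), ∃ b : MonoidAlgebra k G,
      b • m = σ.asModuleEquiv.symm (E i j (σ.asModuleEquiv m)) := by
    intro i j m
    obtain ⟨b, hb⟩ := hρ (Matrix.single i j 1)
    refine ⟨b, ?_⟩
    apply σ.asModuleEquiv.injective
    rw [Representation.asModuleEquiv_map_smul, hψ, hb, LinearEquiv.apply_symm_apply]
  -- `σ g` in terms of the matrix units
  have hσE : ∀ g, σ g = (ρ g 0 0) • E 0 0 + (ρ g 0 1) • E 0 1 + (ρ g 1 0) • E 1 0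
      + (ρ g 1 1) • E 1 1 := by
    intro g
    have hdec : ρ g = (ρ g 0 0) • Matrix.single 0 0 (1 : k) + (ρ g 0 1) • Matrix.single 0 1 1
        + (ρ g 1 0) • Matrix.single 1 0 1 + (ρ g 1 1) • Matrix.single 1 1 1 := by
      ext i j; fin_cases i <;> fin_cases j <;> simp [Matrix.single]
    rw [← Representation.asAlgebraHom_of, hψ, lift_of]
    conv_lhs => rw [hdec]
    simp only [map_add, map_smul, E]
  have hσw : ∀ (g : G) (w : M), E 0 0 w = w →
      σ g w = (ρ g 0 0) • w + (ρ g 1 0) • E 1 0 w := by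
    intro g w hw
    have h01 : E 0 1 w = 0 := by conv_lhs => rw [← hw]; exact hEEv' 0 1 0 0 w (by decide)
    have h11 : E 1 1 w = 0 := by conv_lhs => rw [← hw]; exact hEEv' 1 1 0 0 w (by decide)
    rw [hσE]
    simp only [LinearMap.add_apply, LinearMap.smul_apply, hw, h01, h11, smul_zero, add_zero]
  have hσw' : ∀ (g : G) (w : M), E 0 0 w = w →
      σ g (E 1 0 w) = (ρ g 0 1) • w + (ρ g 1 1) • E 1 0 w := by
    intro g w hw
    rw [hσE]
    simp only [LinearMap.add_apply, LinearMap.smul_apply, hEEv, hw,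
      hEEv' 0 0 1 0 w (by decide), hEEv' 1 0 1 0 w (by decide), smul_zero, zero_add, add_zero]
  -- the embeddings `f_w : V ↪ M`, `v ↦ v₀ w + v₁ E₁₀ w`, for `0 ≠ w ∈ E₀₀ M`
  have key : ∀ w : M, E 0 0 w = w → w ≠ 0 →
      ∃ f : V.asModule →ₗ[MonoidAlgebra k G] σ.asModule, Function.Injective f ∧
        ∀ v, σ.asModuleEquiv (f v) = (V.asModuleEquiv v 0) • w + (V.asModuleEquiv v 1) • E 1 0 w := by
    intro w hw hw0
    let fl : (Fin 2 → k) →ₗ[k] M :=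
      (LinearMap.proj 0 : (Fin 2 → k) →ₗ[k] k).smulRight w
        + (LinearMap.proj 1 : (Fin 2 → k) →ₗ[k] k).smulRight (E 1 0 w)
    have hfl : ∀ v, fl v = v 0 • w + v 1 • E 1 0 w := fun v => by
      simp [fl, LinearMap.smulRight_apply]
    have hint : ∀ (g : G) (v : Fin 2 → k), fl (V g v) = σ g (fl v) := by
      intro g v
      rw [hfl, hfl, map_add, map_smul, map_smul, hσw g w hw, hσw' g w hw]
      simp only [V, MonoidHom.comp_apply, Representation.ofDistribMulAction_apply_apply,
        Matrix.smul_eq_mulVec, Matrix.mulVec, dotProduct, Fin.sum_univ_two]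
      module
    let F : V.asModule →ₗ[MonoidAlgebra k G] σ.asModule :=
      Representation.IntertwiningMap.equivLinearMapAsModule V σ
        (fl.intertwiningMap_of_isIntertwiningMap V σ hint)
    have hF : ∀ v, σ.asModuleEquiv (F v) = (V.asModuleEquiv v 0) • w
        + (V.asModuleEquiv v 1) • E 1 0 w := fun v => hfl v
    refine ⟨F, ?_, hF⟩
    intro v v' hvv'
    have h := congrArg σ.asModuleEquiv hvv'
    rw [hF, hF] at h
    have h0 := congrArg (E 0 0) h
    simp only [map_add, map_smul, hw, hEEv' 0 0 1 0 w (by decide), smul_zero, add_zero] at h0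
    have h1 := congrArg (E 0 1) h
    have h01 : E 0 1 w = 0 := by conv_lhs => rw [← hw]; exact hEEv' 0 1 0 0 w (by decide)
    simp only [map_add, map_smul, h01, hEEv, hw, smul_zero, zero_add] at h1
    apply V.asModuleEquiv.injective
    ext i
    fin_cases i
    · exact smul_left_injective k hw0 h0
    · exact smul_left_injective k hw0 h1
  -- every element decomposes as `m = E₀₀ m + E₁₀ (E₀₁ m)` with `E₀₀ m, E₀₁ m ∈ E₀₀ M`
  have hdecomp : ∀ m : M, m = E 0 0 m + E 1 0 (E 0 1 m) := fun m => by
    rw [hEEv]; exact (hE1v m).symm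
  have hfix0 : ∀ m : M, E 0 0 (E 0 0 m) = E 0 0 m := fun m => hEEv 0 0 0 m
  have hfix1 : ∀ m : M, E 0 0 (E 0 1 m) = E 0 1 m := fun m => hEEv 0 0 1 m
  -- ranges of the `f_w` are simple submodules
  have hsimple : ∀ (f : V.asModule →ₗ[MonoidAlgebra k G] σ.asModule), Function.Injective f →
      IsSimpleModule (MonoidAlgebra k G) (LinearMap.range f) := fun f hf =>
    IsSimpleModule.congr (LinearEquiv.ofInjective f hf).symm
  refine ⟨?_, ?_⟩
  · -- semisimplicity: the simple submodules span everything
    refine IsSemisimpleModule.of_sSup_simples_eq_top (top_le_iff.mp fun m _ => ?_)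
    set S := sSup {N : Submodule (MonoidAlgebra k G) σ.asModule | IsSimpleModule (MonoidAlgebra k G) N}
    -- the two pieces of `m`
    have piece : ∀ w : M, E 0 0 w = w → σ.asModuleEquiv.symm w ∈ S ∧
        σ.asModuleEquiv.symm (E 1 0 w) ∈ S := by
      intro w hw
      by_cases hw0 : w = 0
      · simp [hw0]
      obtain ⟨f, hf, hfv⟩ := key w hw hw0
      have hle : LinearMap.range f ≤ S := le_sSup (hsimple f hf)
      constructor
      · refine hle ⟨V.asModuleEquiv.symm (Pi.single 0 1), ?_⟩
        apply σ.asModuleEquiv.injective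
        rw [hfv]; simp
      · refine hle ⟨V.asModuleEquiv.symm (Pi.single 1 1), ?_⟩
        apply σ.asModuleEquiv.injective
        rw [hfv]; simp
    have hm : m = σ.asModuleEquiv.symm (E 0 0 (σ.asModuleEquiv m))
        + σ.asModuleEquiv.symm (E 1 0 (E 0 1 (σ.asModuleEquiv m))) := by
      apply σ.asModuleEquiv.injective
      rw [map_add, LinearEquiv.apply_symm_apply, LinearEquiv.apply_symm_apply]
      exact hdecomp _
    rw [hm]
    exact S.add_mem (piece _ (hfix0 _)).1 (piece _ (hfix1 _)).2
  · -- isotypic of type `V`: a simple submodule contains some `0 ≠ w ∈ E₀₀ M`, hence `range f_w`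
    intro N hN
    have hNatom : IsAtom N := isSimpleModule_iff_isAtom.mp hN
    obtain ⟨x, hxN, hx0⟩ := Submodule.exists_mem_ne_zero_of_ne_bot hNatom.1
    -- `E i j` preserve `N`
    have hEN : ∀ (i j : Fin 2) (y : σ.asModule), y ∈ N →
        σ.asModuleEquiv.symm (E i j (σ.asModuleEquiv y)) ∈ N := by
      intro i j y hy
      obtain ⟨b, hb⟩ := hEsmul i j y
      rw [← hb]
      exact N.smul_mem b hy
    -- one of `E₀₀ x`, `E₀₁ x` is a nonzero element of `N ∩ E₀₀ M`
    obtain ⟨w, hw, hw0, hwN⟩ : ∃ w : M, E 0 0 w = w ∧ w ≠ 0 ∧ σ.asModuleEquiv.symm w ∈ N := by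
      by_cases h0 : E 0 0 (σ.asModuleEquiv x) = 0
      · refine ⟨E 0 1 (σ.asModuleEquiv x), hfix1 _, fun h1 => hx0 ?_, hEN 0 1 x hxN⟩
        apply σ.asModuleEquiv.injective
        rw [hdecomp (σ.asModuleEquiv x), h0, h1, map_zero, map_zero, add_zero]
      · exact ⟨E 0 0 (σ.asModuleEquiv x), hfix0 _, h0, hEN 0 0 x hxN⟩
    obtain ⟨f, hf, hfv⟩ := key w hw hw0
    -- `range f ≤ N`
    have hle : LinearMap.range f ≤ N := by
      rintro _ ⟨v, rfl⟩
      have hv : f v = (V.asModuleEquiv v 0) • σ.asModuleEquiv.symm w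
          + (V.asModuleEquiv v 1) • σ.asModuleEquiv.symm (E 1 0 w) := by
        apply σ.asModuleEquiv.injective
        rw [hfv, map_add, LinearEquiv.map_smul, LinearEquiv.map_smul,
          LinearEquiv.apply_symm_apply, LinearEquiv.apply_symm_apply]
      rw [hv]
      refine N.add_mem (N.smul_of_tower_mem _ hwN) (N.smul_of_tower_mem _ ?_)
      have := hEN 1 0 _ hwN
      rwa [LinearEquiv.apply_symm_apply] at this
    have hne : LinearMap.range f ≠ ⊥ := by
      intro hbot
      have h1 : f (V.asModuleEquiv.symm (Pi.single 0 1)) = 0 := by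
        have : f (V.asModuleEquiv.symm (Pi.single 0 1)) ∈ LinearMap.range f := ⟨_, rfl⟩
        rw [hbot] at this
        exact (Submodule.mem_bot _).mp this
      have h2 := hf (h1.trans (map_zero f).symm)
      have h3 := congrArg (fun u => V.asModuleEquiv u 0) h2
      simp at h3
    have heq : LinearMap.range f = N := (hNatom.le_iff.mp hle).resolve_left hne
    exact ⟨(LinearEquiv.ofEq _ _ heq).symm.trans (LinearEquiv.ofInjective f hf).symm⟩

/-- **Boston–Lenstra–Ribet, Thm. 1 (semisimplicity).** If `lift ρ : k[G] → M₂(k)` is onto and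
`σ(g)² - tr ρ(g) σ(g) + det ρ(g) = 0` on `M` for all `g`, then `M` is a semisimple `k[G]`-module.
[cite: BostonLenstraRibet1991, Thm. 1] -/
theorem isSemisimpleModule_of_charpolyRel (ρ : G →* Matrix (Fin 2) (Fin 2) k)
    (hρ : Function.Surjective (MonoidAlgebra.lift k (Matrix (Fin 2) (Fin 2) k) G ρ))
    {M : Type*} [AddCommGroup M] [Module k M] (σ : Representation k G M)
    (hσ : ∀ g : G, σ g * σ g - (ρ g).trace • σ g + (ρ g).det • (1 : Module.End k M) = 0) :
    IsSemisimpleModule (MonoidAlgebra k G) σ.asModule :=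
  (structure_aux ρ hρ σ hσ).1

/-- **Boston–Lenstra–Ribet, Thm. 1 (isotypic of type `ρ`).** Under the same hypotheses every
simple `k[G]`-submodule of `M` is isomorphic to the standard module `k²` of `ρ`
(`g ↦ (v ↦ ρ(g) v)`). [cite: BostonLenstraRibet1991, Thm. 1] -/
theorem isIsotypicOfType_of_charpolyRel (ρ : G →* Matrix (Fin 2) (Fin 2) k)
    (hρ : Function.Surjective (MonoidAlgebra.lift k (Matrix (Fin 2) (Fin 2) k) G ρ))
    {M : Type*} [AddCommGroup M] [Module k M] (σ : Representation k G M)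
    (hσ : ∀ g : G, σ g * σ g - (ρ g).trace • σ g + (ρ g).det • (1 : Module.End k M) = 0) :
    IsIsotypicOfType (MonoidAlgebra k G) σ.asModule (Representation.asModule
      ((Representation.ofDistribMulAction k (Matrix (Fin 2) (Fin 2) k) (Fin 2 → k)).comp ρ)) :=
  (structure_aux ρ hρ σ hσ).2

/-- **Boston–Lenstra–Ribet, Thm. 1, as printed: `M` is a direct sum of copies of `ρ`.** Under the
same hypotheses there is a `k[G]`-linear isomorphism `M ≅ ⨁_{i ∈ ι} k²` with `G` acting on each
copy of `k²` through `ρ`. [cite: BostonLenstraRibet1991, Thm. 1] -/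
theorem exists_linearEquiv_finsupp_of_charpolyRel (ρ : G →* Matrix (Fin 2) (Fin 2) k)
    (hρ : Function.Surjective (MonoidAlgebra.lift k (Matrix (Fin 2) (Fin 2) k) G ρ))
    {M : Type u} [AddCommGroup M] [Module k M] (σ : Representation k G M)
    (hσ : ∀ g : G, σ g * σ g - (ρ g).trace • σ g + (ρ g).det • (1 : Module.End k M) = 0) :
    ∃ ι : Type u, Nonempty (σ.asModule ≃ₗ[MonoidAlgebra k G] (ι →₀ Representation.asModule
      ((Representation.ofDistribMulAction k (Matrix (Fin 2) (Fin 2) k) (Fin 2 → k)).comp ρ))) := by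
  haveI := isSemisimpleModule_of_charpolyRel ρ hρ σ hσ
  exact (isIsotypicOfType_of_charpolyRel ρ hρ σ hσ).linearEquiv_finsupp

/-- **Boston–Lenstra–Ribet, Thm. 1, finite-dimensional form: `M ≅ ρ^n`.** Under the same
hypotheses, if `M` is finite-dimensional over `k` then `M ≅ (k²)^n` as `k[G]`-modules for some
`n` (the *multiplicity*). [cite: BostonLenstraRibet1991, Thm. 1] -/
theorem exists_linearEquiv_fin_of_charpolyRel (ρ : G →* Matrix (Fin 2) (Fin 2) k)
    (hρ : Function.Surjective (MonoidAlgebra.lift k (Matrix (Fin 2) (Fin 2) k) G ρ))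
    {M : Type*} [AddCommGroup M] [Module k M] [Module.Finite k M] (σ : Representation k G M)
    (hσ : ∀ g : G, σ g * σ g - (ρ g).trace • σ g + (ρ g).det • (1 : Module.End k M) = 0) :
    ∃ n : ℕ, Nonempty (σ.asModule ≃ₗ[MonoidAlgebra k G] (Fin n → Representation.asModule
      ((Representation.ofDistribMulAction k (Matrix (Fin 2) (Fin 2) k) (Fin 2 → k)).comp ρ))) := by
  haveI := isSemisimpleModule_of_charpolyRel ρ hρ σ hσ
  haveI : Module.Finite (MonoidAlgebra k G) σ.asModule :=
    Module.Finite.of_restrictScalars_finite k (MonoidAlgebra k G) σ.asModule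
  exact (isIsotypicOfType_of_charpolyRel ρ hρ σ hσ).linearEquiv_fun

/-- **Multiplicity count** (Ribet–Stein §3.3: "`J[𝔪] ≈ ⨁_{i=1}^t V_𝔪`", so `dim J[𝔪] = 2t`): under
the hypotheses of [BLR, Thm. 1] a finite-dimensional `M` has even dimension `2n`, `n` the number
of copies of `ρ`. [cite: BostonLenstraRibet1991, Thm. 1] -/
theorem exists_finrank_eq_two_mul_of_charpolyRel (ρ : G →* Matrix (Fin 2) (Fin 2) k)
    (hρ : Function.Surjective (MonoidAlgebra.lift k (Matrix (Fin 2) (Fin 2) k) G ρ))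
    {M : Type*} [AddCommGroup M] [Module k M] [Module.Finite k M] (σ : Representation k G M)
    (hσ : ∀ g : G, σ g * σ g - (ρ g).trace • σ g + (ρ g).det • (1 : Module.End k M) = 0) :
    ∃ n : ℕ, Module.finrank k M = 2 * n := by
  obtain ⟨n, ⟨e⟩⟩ := exists_linearEquiv_fin_of_charpolyRel ρ hρ σ hσ
  set V : Representation k G (Fin 2 → k) :=
    (Representation.ofDistribMulAction k (Matrix (Fin 2) (Fin 2) k) (Fin 2 → k)).comp ρ with hV
  have hV2 : Module.finrank k V.asModule = 2 := by
    rw [V.asModuleEquiv.finrank_eq, Module.finrank_fin_fun]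
  refine ⟨n, calc Module.finrank k M = Module.finrank k σ.asModule := σ.asModuleEquiv.finrank_eq.symm
    _ = Module.finrank k (Fin n → V.asModule) := (e.restrictScalars k).finrank_eq
    _ = 2 * n := by
      rw [Module.finrank_pi_fintype, Finset.sum_const, Finset.card_univ, Fintype.card_fin, hV2,
        smul_eq_mul, mul_comm]⟩

end Field

section Burnside

variable {k : Type*} [Field k] [IsAlgClosed k] {G : Type*} [Group G]

/-- **Burnside's theorem as the bridge to [BLR]'s hypothesis.** Over an algebraically closed field,
if the standard representation `g ↦ (v ↦ ρ(g) v)` of a multiplicative `ρ : G → Mₙ(k)` (`n ≥ 1`)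
is irreducible (Mathlib `Representation.IsIrreducible`), then the matrices `ρ(g)` span `Mₙ(k)`:
`MonoidAlgebra.lift ρ : k[G] → Mₙ(k)` is onto. (The `k`-subalgebra generated by the `ρ(g)` acts
irreducibly on `kⁿ`, hence is all of `End(kⁿ)` by Burnside,
`Literature.NumberTheory.Automorphic.ActsIrreducibly.eq_top`.)
[cite: Lam2001FirstCourse, (7.3) and the remark following it (Burnside's theorem)] -/
theorem lift_surjective_of_isIrreducible {n : Type*} [Fintype n] [DecidableEq n] [Nonempty n]
    (ρ : G →* Matrix n n k)
    (hirr : Representation.IsIrreducible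
      ((Representation.ofDistribMulAction k (Matrix n n k) (n → k)).comp ρ)) :
    Function.Surjective (MonoidAlgebra.lift k (Matrix n n k) G ρ) := by
  classical
  set V : Representation k G (n → k) :=
    (Representation.ofDistribMulAction k (Matrix n n k) (n → k)).comp ρ with hV
  set φ := MonoidAlgebra.lift k (Matrix n n k) G ρ with hφ
  -- `V.asAlgebraHom x = toLin' (φ x)`
  have hact : ∀ x : MonoidAlgebra k G, V.asAlgebraHom x = Matrix.toLin' (φ x) := by
    intro x
    induction x using MonoidAlgebra.induction_on with
    | hM g =>
      apply LinearMap.ext; intro v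
      rw [Representation.asAlgebraHom_of, lift_of, Matrix.toLin'_apply, hV, MonoidHom.comp_apply,
        Representation.ofDistribMulAction_apply_apply, Matrix.smul_eq_mulVec]
    | hadd x y ex ey => rw [map_add, map_add, map_add, ex, ey]
    | hsmul r x ex => rw [map_smul, map_smul, map_smul, ex]
  -- the range of `V.asAlgebraHom` acts irreducibly
  set A : Subalgebra k (Module.End k (n → k)) := V.asAlgebraHom.range with hA
  have hAirr : Literature.NumberTheory.Automorphic.ActsIrreducibly A := by
    intro W hW
    let W' : Subrepresentation V := ⟨W, fun g v hv => by
      have := hW (V.asAlgebraHom (of k G g)) ⟨of k G g, rfl⟩ v hv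
      rwa [Representation.asAlgebraHom_of] at this⟩
    rcases hirr.eq_bot_or_eq_top W' with h | h
    exacts [Or.inl (congrArg Subrepresentation.toSubmodule h),
      Or.inr (congrArg Subrepresentation.toSubmodule h)]
  have htop := hAirr.eq_top
  intro X
  have hX : Matrix.toLin' X ∈ A := by rw [htop]; exact Algebra.mem_top
  obtain ⟨x, hx⟩ := hX
  refine ⟨x, Matrix.toLin'.injective ?_⟩
  rw [← hact, ← hx]
  rfl

end Burnside

end Literature.Algebra.GroupRings
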